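import Literature.AlgebraicGeometry.Motives.MixedHodgeStructureSplitOverQGraded
import HarnessLib

/-!
# `ℚ`-split mixed Hodge structures are exactly the direct sums of pure Hodge structures

Green–Griffiths–Kerr, *Mumford–Tate groups and domains*, §I.C footnote 3: "the case of `ℚ`-split MHS, i.e.,
'general Hodge structures'" — direct sums of pure Hodge structures of possibly different weights, `V^split =
⊕ᵢ Gr^W_i V` ((I.C.7)); (I.C.11) (iii): "`V^split` is a direct sum of pure Hodge structures". Cattani–El
Zein–Griffiths–Lê, Ex. 3.2.23 (2): a direct sum of pure Hodge structures of various weights is a mixed Hodge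
structure; Thm. 3.2.18.

Closing the circle of `Motives/MixedHodgeStructureSplitOverQ` (definition via the Deligne grading, equivalence
with the vanishing of Carlson's weight classes) and `Motives/MixedHodgeStructureSplitOverQGraded`
(`H ≅ ⊕_{n ∈ s} Gr^W_n H` for `ℚ`-split `H`):

* §1 **direct sums of pure Hodge structures are `ℚ`-split** (`isSplitOverQ_pi_toMixedHodgeStructure`), and so is
  anything isomorphic to one (`isSplitOverQ_of_hom_pi_pure_bijective`, either direction of the isomorphism).
* §2 **`H` is `ℚ`-split iff `H ≅ ⊕_{n ∈ s} Gr^W_n H` for some finite set `s` of weights**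
  (`isSplitOverQ_iff_exists_hom_pi_gr_bijective`), iff every `W_n` is an MHS-direct summand, iff all weight
  classes vanish (recorded together as `isSplitOverQ_tfae`-style corollaries).

All statements proved; no definitions, no named facts.

## References

* [GreenGriffithsKerr2012] M. Green, P. Griffiths, M. Kerr, Mumford–Tate groups and domains (2012), §I.C
  (I.C.7), (I.C.11) (iii), footnote 3.
* [CattaniElZeinGriffithsLe2014] E. Cattani et al. (eds.), Hodge Theory (2014), Thm. 3.2.18, Ex. 3.2.23 (2).
-/

noncomputable section

open scoped TensorProduct

namespace Literature.AlgebraicGeometry.Motives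

namespace MixedHodgeStructure

universe u v w

/-! ### §1 Direct sums of pure Hodge structures -/

section Pure

variable {ι : Type w} [Fintype ι] [DecidableEq ι]
variable {W : ι → Type v} [∀ j, AddCommGroup (W j)] [∀ j, Module ℚ (W j)]

/-- **A finite direct sum `⊕ⱼ Hⱼ` of pure Hodge structures (of arbitrary weights `kⱼ`) is split over `ℚ`.**
[cite: GreenGriffithsKerr2012, §I.C footnote 3] [cite: CattaniElZeinGriffithsLe2014, Ex. 3.2.23 (2)] -/
theorem isSplitOverQ_pi_toMixedHodgeStructure {k : ι → ℤ} (Hs : ∀ j, HodgeStructure (W j) (k j)) :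
    (pi fun j => (Hs j).toMixedHodgeStructure).IsSplitOverQ :=
  isSplitOverQ_pi fun j => isSplitOverQ_toMixedHodgeStructure (Hs j)

variable {V : Type u} [AddCommGroup V] [Module ℚ V] {H : MixedHodgeStructure V}

/-- **A mixed Hodge structure isomorphic to a direct sum of pure Hodge structures is `ℚ`-split** (isomorphism
`⊕ⱼ Hⱼ → H`). [cite: GreenGriffithsKerr2012, §I.C (I.C.11) (iii)] -/
theorem isSplitOverQ_of_hom_pi_pure_bijective [FiniteDimensional ℚ V] [∀ j, FiniteDimensional ℚ (W j)]
    {k : ι → ℤ} (Hs : ∀ j, HodgeStructure (W j) (k j)) (f : Hom (pi fun j => (Hs j).toMixedHodgeStructure) H)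
    (hf : Function.Bijective f.toLinearMap) : H.IsSplitOverQ :=
  (isSplitOverQ_pi_toMixedHodgeStructure Hs).of_bijective f hf

/-- The same with the isomorphism in the direction `H → ⊕ⱼ Hⱼ`. [cite: GreenGriffithsKerr2012, §I.C (I.C.11) (iii)] -/
theorem isSplitOverQ_of_hom_pi_pure_bijective' [FiniteDimensional ℚ V] [∀ j, FiniteDimensional ℚ (W j)]
    {k : ι → ℤ} (Hs : ∀ j, HodgeStructure (W j) (k j)) (f : Hom H (pi fun j => (Hs j).toMixedHodgeStructure))
    (hf : Function.Bijective f.toLinearMap) : H.IsSplitOverQ :=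
  (isSplitOverQ_iff_of_bijective f hf).2 (isSplitOverQ_pi_toMixedHodgeStructure Hs)

end Pure

/-! ### §2 The characterisation -/

variable {V : Type u} [AddCommGroup V] [Module ℚ V] {H : MixedHodgeStructure V}

/-- **`H` is split over `ℚ` iff `⊕_{n ∈ s} Gr^W_n H ≅ H` for some finite set `s` of weights** ("`ℚ`-split MHS
= general Hodge structures `⊕ Gr^W_i V`"). [cite: GreenGriffithsKerr2012, §I.C (I.C.7), footnote 3] -/
theorem isSplitOverQ_iff_exists_hom_pi_gr_bijective [FiniteDimensional ℚ V] :
    H.IsSplitOverQ ↔ ∃ (s : Finset ℤ) (f : Hom (pi fun n : ↥s => (H.gr n).toMixedHodgeStructure) H),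
      Function.Bijective f.toLinearMap :=
  ⟨fun h => h.exists_finset_hom_pi_gr_bijective,
    fun ⟨s, f, hf⟩ => isSplitOverQ_of_hom_pi_pure_bijective (fun n : ↥s => H.gr (n : ℤ)) f hf⟩

/-- **`H` is split over `ℚ` iff `⊕_{n ∈ s} Gr^W_n H ≅ H` for EVERY finite `s` containing the weights of `H`**
(those `n` with `Gr^W_n H ≠ 0`). [cite: GreenGriffithsKerr2012, §I.C (I.C.7), footnote 3] -/
theorem IsSplitOverQ.exists_hom_pi_gr_bijective_of_forall [FiniteDimensional ℚ V] (h : H.IsSplitOverQ)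
    {s : Finset ℤ} (hs : ∀ n, n ∉ s → Subsingleton (grW H.W n)) :
    ∃ f : Hom (pi fun n : ↥s => (H.gr n).toMixedHodgeStructure) H, Function.Bijective f.toLinearMap := by
  refine h.exists_hom_pi_gr_bijective fun n hn => ?_
  haveI := hs n hn
  -- `U_n ≅ Gr^W_n H = 0`
  have hb := h.weightPieceGrHom_bijective n
  rw [eq_bot_iff]
  intro x hx
  have h0 : (h.weightPieceGrHom n).toLinearMap ⟨x, hx⟩ = (h.weightPieceGrHom n).toLinearMap 0 := Subsingleton.elim _ _
  have h1 := hb.1 h0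
  rw [Submodule.mem_bot]
  exact congrArg Subtype.val h1

/-- **Summary of the characterisations of `ℚ`-split mixed Hodge structures**: (1) the Deligne grading is
defined over `ℚ`; (2) every `W_n` is an MHS-direct summand; (3) all Carlson weight classes vanish; (4)
`H ≅ ⊕_{n ∈ s} Gr^W_n H`. [cite: GreenGriffithsKerr2012, §I.C (I.C.7)–(I.C.8), footnote 3] -/
theorem isSplitOverQ_tfae [FiniteDimensional ℚ V] :
    [H.IsSplitOverQ,
      ∀ n : ℤ, ∃ T : SubMixedHodgeStructure H, IsCompl (H.W n) T.toSubmodule,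
      ∀ n : ℤ, H.weightClass n = 0,
      ∃ (s : Finset ℤ) (f : Hom (pi fun n : ↥s => (H.gr n).toMixedHodgeStructure) H),
        Function.Bijective f.toLinearMap].TFAE := by
  tfae_have 1 ↔ 2 := isSplitOverQ_iff_forall_exists_isCompl
  tfae_have 1 ↔ 3 := isSplitOverQ_iff_forall_weightClass_eq_zero
  tfae_have 1 ↔ 4 := isSplitOverQ_iff_exists_hom_pi_gr_bijective
  tfae_finish

end MixedHodgeStructure

end Literature.AlgebraicGeometry.Motives
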